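import Summits.BirchSwinnertonDyer.BirchSwinnertonDyer.Theorems.PrintCf2RamifiedTYZProvedNoLLT
import Summits.BirchSwinnertonDyer.Rank1Residual.P2.CongruentNumberGenusFamiliesKernelDescent
import Literature.NumberTheory.EllipticCurves.Tian2014.CMPointSystemGenusBridge
import HarnessLib

/-!
# Route `PrintCf2`, leaf `WAllCornerFTwoRamifiedTYZProved` (item 20508, CLOSED) — THE WHOLE FLAG-FREE TYZ LEAF MODULO
# TWO NAMED FACTS: TYZ 2017 Thm 1.2 AS PRINTED + Gross–Zagier–Kolyvagin (cell `bsd-print-cf2`, seat p2, g4; file 5)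

HONEST FRAMING (cell `bsd-print-cf2`, HOME `run/shared/lean/pub/bsd-print-cf2/`): THEOREMS ONLY — no definition, no named
fact, nothing asserted, nothing booked, no count moved. ASSEMBLY of tree theorems: p1's closer of the flag-free TYZ leaf
`WAll.PrintCf2.wAllCornerFTwoRamifiedTYZProved_of_facts` takes SIX named facts (`h12`, `h13` Tian 2014 Thm 1.3, `hR`
Rédei–Reichardt, `hLLT` Li–Liu–Tian 2024 Thm 1.2, `h515` Monsky 1990 Cor 5.15 (2), `hGZK`). Every disjunct of
`CongruentTYZProvedFamily` is in fact a TYZρ member or has a `{h12, hGZK}` door already in the tree: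
* LLT and T5 — file 4 (`cornerFTwo_congruentFamilyLLT_of_tyz`, `cornerFTwo_tianClassFive_of_tyz`; this seat, p570846:
  2-descent kernel `{0,(𝟙;𝟙)}`, `Σ₁ ≡ z·𝟙` by Smith's row 5a, Rédei–Reichardt discharged);
* T7 (`p₀ ≡ 7`, `pᵢ ≡ 1 (8)`, odd graph) — `P2.rankOne_sha_bsdp_two_congruentNumberCurve_caseSeven_descent (h12) (hGZK)`
  (cell p2 g1, kernel `{0,(𝟙;0)}`, `ρ = 0` by Faulkner–James, `Σ₁` odd by Rédei–Reichardt — all tree theorems);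
* M35 (`pq`, `p ≡ 3`, `q ≡ 5 (8)`) — `P2.rankOne_sha_bsdp_two_congruentNumberCurve_three_five_descent (h12) (hGZK)` (p2 g1);
* TYZρ — `WAll.PrintCf2.cornerFTwo_tyzGenusRho (h12) (hGZK)` (p1).
Hence **`wAllCornerFTwoRamifiedTYZProved_of_tyz_gzk (h12) (hGZK) : WAllCornerFTwoRamifiedTYZProved`** — the flag-free TYZ
leaf of crux 20362 / item 20508 modulo conjuncts 5 (TYZ 2017 Thm 1.2 AS PRINTED) and 1 (GZK) of `𝔅_ram` ONLY; conjuncts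
6 (Tian 2014 Thm 1.3), 7 (Rédei–Reichardt, a tree theorem anyway), 8 (Li–Liu–Tian 2024 Thm 1.2) and 9 (Monsky 1990
Cor 5.15 (2)) are IDLE for this leaf (they remain used elsewhere only through p1's older closers). In the currency of
the crux: `ramifiedTYZProved_of_bundle_twoFacts : 𝔅_ram → WAllCornerFTwoRamifiedTYZProved` using `hB.1` and
`hB.2.2.2.2.1` only. Beyond print: YES for LLT/T5/T7/M35 as kernel assemblies (the printed `2`-part statements of
LLT24 / Tian ICM22 Thm 8 are not used). PARTITION: 0 cells moved (20508 is closed); hypothesis hygiene only.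

## References
* [TianYuanZhang2017] Thm. 1.2 (as printed), §1 (ρ(n)). * [LiLiuTian2024] Thm. 1.2. * [Tian2014] Thm. 1.3, Lemma 5.1/5.3.
* [Monsky1990MockHeegner] Cor. 5.15 (2). * [LiMa2008] Thm. 0.4. * [Smith2016CongruentDensity] Thm. 2.2 row 5a.
* [FaulknerJames2007] Thm. 1.2 (2). * [Miller2011LMS] Def. 1.1.
-/

noncomputable section

open scoped Classical

open Matrix Finset WeierstrassCurve
open Literature.NumberTheory.EllipticCurves
open Literature.NumberTheory.EllipticCurves.Rank1Residual
open Literature.NumberTheory.EllipticCurves.HeathBrown1994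
open Literature.NumberTheory.EllipticCurves.TianYuanZhang2017
open Summit.BirchSwinnertonDyer Summit.BirchSwinnertonDyer.Rank1Residual

set_option autoImplicit false

namespace Summit.BirchSwinnertonDyer.PrintCf2

/-- **SLICE T7 modulo `{h12, hGZK}`** (leaf shape): Tian's class 7 (`p₀ ≡ 7`, `pᵢ ≡ 1 (mod 8)`, odd Legendre graph) via
the tree's kernel door `P2.rankOne_sha_bsdp_two_congruentNumberCurve_caseSeven_descent` and fact-free model transport.
[cite: Tian2014, Thm. 1.3 and Lemma 5.1/5.3] [cite: TianYuanZhang2017, Thm. 1.2] [cite: FaulknerJames2007, Thm. 1.2 (2)]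
[cite: Miller2011LMS, Def. 1.1] -/
theorem cornerFTwo_tianClassSeven_of_tyz (h12 : thm12_parity_of_scriptL')
    (hGZK : rank_eq_analyticRank_of_analyticRank_le_one) :
    ∀ (W : WeierstrassCurve ℚ) [W.IsElliptic] [W.IsGloballyMinimal], W.HasCM → W.analyticRank = 1 →
      ∀ (k : ℕ) (p : Fin (k + 1) → ℕ), (∀ i, (p i).Prime) → Function.Injective p → p 0 % 8 = 7 →
        (∀ i, i ≠ 0 → p i % 8 = 1) → (∀ v, legendreMatrix p *ᵥ v = 0 → v = 0 ∨ v = fun _ => 1) →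
        ∀ (C : VariableChange ℚ), C • congruentNumberCurve (∏ i, p i) = W → BSDp W 2 := by
  intro W _ _ _ _ k p hp hinj h7 h1 hG C hC
  have hsq : Squarefree (∏ i, p i) := squarefree_prod_of_injective p hp hinj
  have h := P2.rankOne_sha_bsdp_two_congruentNumberCurve_caseSeven_descent p h12 hGZK hp hinj h7 h1 hG rfl
  exact (P2.CornerFTwo.CongruentNumber.analyticRank_eq_one_and_bsdp_two_of_smul hsq ⟨h.1, h.2.2.2⟩ hC).2

/-- **SLICE M35 modulo `{h12, hGZK}`** (leaf shape): `n = pq`, `p ≡ 3`, `q ≡ 5 (mod 8)`, via the tree's kernel door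
`P2.rankOne_sha_bsdp_two_congruentNumberCurve_three_five_descent` (Monsky 1990 Cor 5.15 NOT used: `#Sel₂ = 8` is the tree's
`P2.card_selmerGroup_two_eq_eight_of_isCor515Family`, the rank is GZK's). [cite: Monsky1990MockHeegner, Cor. 5.15 (2) (p. 66)]
[cite: TianYuanZhang2017, Thm. 1.2] [cite: Miller2011LMS, Def. 1.1] -/
theorem cornerFTwo_threeFive_of_tyz (h12 : thm12_parity_of_scriptL')
    (hGZK : rank_eq_analyticRank_of_analyticRank_le_one) :
    ∀ (W : WeierstrassCurve ℚ) [W.IsElliptic] [W.IsGloballyMinimal], W.HasCM → W.analyticRank = 1 →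
      ∀ (p q : ℕ), p.Prime → q.Prime → p % 8 = 3 → q % 8 = 5 →
        ∀ (C : VariableChange ℚ), C • congruentNumberCurve (p * q) = W → BSDp W 2 := by
  intro W _ _ _ _ p q hp hq hp3 hq5 C hC
  have hsq : Squarefree (p * q) := by
    rw [Nat.squarefree_mul ((Nat.coprime_primes hp hq).mpr (fun h => by omega))]
    exact ⟨hp.squarefree, hq.squarefree⟩
  have h := P2.rankOne_sha_bsdp_two_congruentNumberCurve_three_five_descent h12 hGZK hp hq hp3 hq5
  exact (P2.CornerFTwo.CongruentNumber.analyticRank_eq_one_and_bsdp_two_of_smul hsq ⟨h.1, h.2.2.2⟩ hC).2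

/-- **THE FLAG-FREE TYZ LEAF MODULO TWO NAMED FACTS** — TYZ 2017 Thm 1.2 AS PRINTED (`h12`) and Gross–Zagier–Kolyvagin
(`hGZK`): every globally minimal CM curve of analytic rank one with `2` ramified that is a `ℚ`-model of a member of
`CongruentTYZProvedFamily` (LLT ∨ T5 ∨ T7 ∨ M35 ∨ TYZρ) satisfies `BSD(E, 2)`. Compare p1's
`wAllCornerFTwoRamifiedTYZProved_of_facts (h12) (h13) (hR) (hLLT) (h515) (hGZK)`: Tian 2014 Thm 1.3, Li–Liu–Tian 2024 Thm 1.2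
and Monsky 1990 Cor 5.15 are idle, Rédei–Reichardt is a tree theorem. [cite: TianYuanZhang2017, Thm. 1.2]
[cite: LiLiuTian2024, Thm. 1.2] [cite: Tian2014, Thm. 1.3] [cite: Monsky1990MockHeegner, Cor. 5.15 (2)] [cite: Miller2011LMS, Def. 1.1] -/
theorem wAllCornerFTwoRamifiedTYZProved_of_tyz_gzk (h12 : thm12_parity_of_scriptL')
    (hGZK : rank_eq_analyticRank_of_analyticRank_le_one) : WAllCornerFTwoRamifiedTYZProved := by
  intro W _ _ hcm hr _ hmem
  rcases hmem with hW | ⟨k, p, hp, hinj, h4, h5, hG, C, hC⟩ | ⟨k, p, hp, hinj, h7, h1, hG, C, hC⟩ |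
      ⟨p, q, hp, hq, hp3, hq5, C, hC⟩ | ⟨n, hsq, h8, hsel, hρ, hgen, C, hC⟩
  · exact cornerFTwo_congruentFamilyLLT_of_tyz h12 hGZK W hcm hr hW
  · exact cornerFTwo_tianClassFive_of_tyz h12 hGZK W hcm hr k p hp hinj h4 h5 hG C hC
  · exact cornerFTwo_tianClassSeven_of_tyz h12 hGZK W hcm hr k p hp hinj h7 h1 hG C hC
  · exact cornerFTwo_threeFive_of_tyz h12 hGZK W hcm hr p q hp hq hp3 hq5 C hC
  · exact WAll.PrintCf2.cornerFTwo_tyzGenusRho h12 hGZK W hcm hr n hsq h8 hsel hρ hgen C hC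

/-- **IN THE CURRENCY OF THE CRUX** (`𝔅_ram`, the eleven conjuncts of items 20362/20508/20509, verbatim): the flag-free TYZ
leaf follows from conjuncts 1 (GZK) and 5 (TYZ Thm 1.2′) ALONE — the same statement as the registered (closed) stub
`PrintCf2.stub_ramified_onTYZProvedFamilies` (p1, which used conjuncts 1, 5, 6, 7, 8, 9).
[cite: TianYuanZhang2017, Thm. 1.2] [cite: Miller2011LMS, Def. 1.1] -/
theorem ramifiedTYZProved_of_bundle_twoFacts :
    (Literature.NumberTheory.EllipticCurves.rank_eq_analyticRank_of_analyticRank_le_one ∧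
      WeierstrassCurve.hasEntireLFunction_rat ∧ WeierstrassCurve.bsdRHS_eq_of_isIsogenous ∧
      Literature.NumberTheory.EllipticCurves.bsdTriple_of_hasCM_of_L_one_ne_zero ∧
      Literature.NumberTheory.EllipticCurves.TianYuanZhang2017.thm12_parity_of_scriptL' ∧
      Literature.NumberTheory.EllipticCurves.Tian2014.thm13_rank_one_and_sha_odd ∧
      Literature.NumberTheory.QuadraticFields.RedeiReichardt.redeiReichardt_fourTwoCard_classGroup ∧
      Literature.NumberTheory.EllipticCurves.LiLiuTian2024.thm12_bsd_congruentNumberCurve ∧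
      Literature.NumberTheory.EllipticCurves.Monsky1990.cor515_rank_eq_one_and_card_selmerGroup_two ∧
      Literature.NumberTheory.EllipticCurves.HeathBrown1994.monsky_card_selmerGroup_two_even ∧
      Literature.NumberTheory.EllipticCurves.Tian2014.tian2014_system_sMinus_genus) →
    Summit.BirchSwinnertonDyer.WAllCornerFTwoRamifiedTYZProved :=
  fun hB => wAllCornerFTwoRamifiedTYZProved_of_tyz_gzk hB.2.2.2.2.1 hB.1

end Summit.BirchSwinnertonDyer.PrintCf2

end
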